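import Mathlib
import Literature.Barriers.HubbardSuperconductivity.WeakCouplingCeiling
import HarnessLib

/-!
# Taylor-type bounds for `sinh`, `cosh` on `[0, 1]`

Stub `stub_hyperbolicBounds` for the line *parity–multiplicity–commutator* of the crux
`GroundStateSimpleEven` (Weil ground state): for `0 ≤ b ≤ 1`,

* `0 ≤ 2b cosh(b/2) − 4 sinh(b/2)` — this is `4 (x cosh x − sinh x)` at `x = b/2`, and
  `sinh x ≤ x cosh x` (`tanh x ≤ x`) is the tree lemma
  `Literature.Barriers.HubbardSuperconductivity.sinh_le_self_mul_cosh`;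
* `2b cosh(b/2) − 4 sinh(b/2) ≤ b³/6 + b⁵/200` and `sinh b − b ≤ b³/6 + b⁵/100` — from Mathlib's
  Taylor remainder estimate `Real.exp_bound` (`|eˣ − Σ_{m<n} xᵐ/m!| ≤ |x|ⁿ (n+1)/(n!·n)` on
  `|x| ≤ 1`) at `± x` with `n = 5` (remainder `|x|⁵/100`) and `n = 7` (remainder `|x|⁷/4410`),
  combined through `cosh x = (eˣ + e⁻ˣ)/2`, `sinh x = (eˣ − e⁻ˣ)/2`; the series
  `x cosh x − sinh x = x³/3 + x⁵/30 + x⁷/840 + ⋯` leaves the slack `x⁵/150` for the remainders.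
-/

open Set MeasureTheory Filter

open scoped Real Topology

namespace Summit.RiemannHypothesis.RiemannHypothesis.Theorems

namespace GroundStateSimpleEven

set_option linter.dupNamespace false in
/-- Taylor's estimate for `exp` with five terms on `[-1, 1]`: Mathlib's `Real.exp_bound` with
`n = 5`, remainder `|x|⁵ · 6/(5!·5) = |x|⁵/100`. [folklore] -/
theorem hyp_abs_exp_sub_taylor_five_le {x : ℝ} (hx : |x| ≤ 1) :
    |Real.exp x - (1 + x + x ^ 2 / 2 + x ^ 3 / 6 + x ^ 4 / 24)| ≤ |x| ^ 5 / 100 := by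
  have h := Real.exp_bound hx (n := 5) (by norm_num)
  calc |Real.exp x - (1 + x + x ^ 2 / 2 + x ^ 3 / 6 + x ^ 4 / 24)|
        = |Real.exp x - ∑ m ∈ Finset.range 5, x ^ m / (m.factorial : ℝ)| := by
        congr 1
        simp only [Finset.sum_range_succ, Finset.sum_range_zero, Nat.factorial]
        push_cast
        ring
    _ ≤ _ := h
    _ = |x| ^ 5 / 100 := by
        norm_num [Nat.factorial]
        ring

set_option linter.dupNamespace false in
/-- Taylor's estimate for `exp` with seven terms on `[-1, 1]`: Mathlib's `Real.exp_bound` with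
`n = 7`, remainder `|x|⁷ · 8/(7!·7) = |x|⁷/4410`. [folklore] -/
theorem hyp_abs_exp_sub_taylor_seven_le {x : ℝ} (hx : |x| ≤ 1) :
    |Real.exp x - (1 + x + x ^ 2 / 2 + x ^ 3 / 6 + x ^ 4 / 24 + x ^ 5 / 120 + x ^ 6 / 720)| ≤
      |x| ^ 7 / 4410 := by
  have h := Real.exp_bound hx (n := 7) (by norm_num)
  calc |Real.exp x - (1 + x + x ^ 2 / 2 + x ^ 3 / 6 + x ^ 4 / 24 + x ^ 5 / 120 + x ^ 6 / 720)|
        = |Real.exp x - ∑ m ∈ Finset.range 7, x ^ m / (m.factorial : ℝ)| := by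
        congr 1
        simp only [Finset.sum_range_succ, Finset.sum_range_zero, Nat.factorial]
        push_cast
        ring
    _ ≤ _ := h
    _ = |x| ^ 7 / 4410 := by
        norm_num [Nat.factorial]
        ring

set_option linter.dupNamespace false in
/-- `sinh b − b ≤ b³/6 + b⁵/100` for `0 ≤ b ≤ 1`: the five-term Taylor estimates of `e^{±b}`
(remainder `b⁵/100` each) in `sinh b = (e^b − e^{-b})/2`. [folklore] -/
theorem hyp_sinh_sub_self_le {b : ℝ} (hb : 0 ≤ b) (hb1 : b ≤ 1) :
    Real.sinh b - b ≤ b ^ 3 / 6 + b ^ 5 / 100 := by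
  have h1 := abs_le.1 (hyp_abs_exp_sub_taylor_five_le (x := b) (by rwa [abs_of_nonneg hb]))
  have h2 := abs_le.1
    (hyp_abs_exp_sub_taylor_five_le (x := -b) (by rwa [abs_neg, abs_of_nonneg hb]))
  rw [abs_of_nonneg hb] at h1
  rw [abs_neg, abs_of_nonneg hb] at h2
  rw [Real.sinh_eq]
  linarith [h1.2, h2.1]

set_option linter.dupNamespace false in
/-- `x cosh x − sinh x ≤ x³/3 + x⁵/25` for `0 ≤ x ≤ 1`: write
`2 (x cosh x − sinh x) = (x − 1) eˣ + (x + 1) e⁻ˣ`, insert the seven-term Taylor estimates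
(`x − 1 ≤ 0 ≤ x + 1`), which gives `x³/3 + x⁵/30 + x⁷ (1/720 + 1/4410)`, and use `x⁷ ≤ x⁵`,
`1/30 + 1/720 + 1/4410 ≤ 1/25`. [folklore] -/
theorem hyp_mul_cosh_sub_sinh_le {x : ℝ} (hx : 0 ≤ x) (hx1 : x ≤ 1) :
    x * Real.cosh x - Real.sinh x ≤ x ^ 3 / 3 + x ^ 5 / 25 := by
  have h1 := abs_le.1 (hyp_abs_exp_sub_taylor_seven_le (x := x) (by rwa [abs_of_nonneg hx]))
  have h2 := abs_le.1
    (hyp_abs_exp_sub_taylor_seven_le (x := -x) (by rwa [abs_neg, abs_of_nonneg hx]))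
  rw [abs_of_nonneg hx] at h1
  rw [abs_neg, abs_of_nonneg hx] at h2
  have hA : (1 - x) * (1 + x + x ^ 2 / 2 + x ^ 3 / 6 + x ^ 4 / 24 + x ^ 5 / 120 + x ^ 6 / 720
      - x ^ 7 / 4410) ≤ (1 - x) * Real.exp x :=
    mul_le_mul_of_nonneg_left (by linarith [h1.1]) (by linarith)
  have hB : (1 + x) * Real.exp (-x) ≤ (1 + x) * (1 + -x + (-x) ^ 2 / 2 + (-x) ^ 3 / 6
      + (-x) ^ 4 / 24 + (-x) ^ 5 / 120 + (-x) ^ 6 / 720 + x ^ 7 / 4410) :=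
    mul_le_mul_of_nonneg_left (by linarith [h2.2]) (by linarith)
  have h75 : x ^ 7 ≤ x ^ 5 := pow_le_pow_of_le_one hx hx1 (by norm_num)
  have h5 : 0 ≤ x ^ 5 := pow_nonneg hx 5
  rw [Real.cosh_eq, Real.sinh_eq]
  linarith

end GroundStateSimpleEven

set_option linter.dupNamespace false in
/-- **(HYP) Hyperbolic Taylor-type bounds on `[0, 1]`.** For `0 ≤ b ≤ 1`:
`0 ≤ 2b cosh(b/2) − 4 sinh(b/2) ≤ b³/6 + b⁵/200` and `sinh b − b ≤ b³/6 + b⁵/100`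
(`2b cosh(b/2) − 4 sinh(b/2) = 4 (x cosh x − sinh x)` at `x = b/2`, and `sinh x ≤ x cosh x` is
the tree lemma `HubbardSuperconductivity.sinh_le_self_mul_cosh`; the upper bounds come from the
Taylor remainder estimate `Real.exp_bound` for `e^{±x}` with `7`, resp. `5`, terms). [folklore] -/
theorem stub_hyperbolicBounds :
    ∀ b : ℝ, 0 ≤ b → b ≤ 1 →
      0 ≤ 2 * b * Real.cosh (b / 2) - 4 * Real.sinh (b / 2) ∧
        2 * b * Real.cosh (b / 2) - 4 * Real.sinh (b / 2) ≤ b ^ 3 / 6 + b ^ 5 / 200 ∧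
        Real.sinh b - b ≤ b ^ 3 / 6 + b ^ 5 / 100 := by
  intro b hb hb1
  have hx : 0 ≤ b / 2 := by positivity
  have hx1 : b / 2 ≤ 1 := by linarith
  refine ⟨?_, ?_, GroundStateSimpleEven.hyp_sinh_sub_self_le hb hb1⟩
  · have h := Literature.Barriers.HubbardSuperconductivity.sinh_le_self_mul_cosh hx
    linarith
  · have h := GroundStateSimpleEven.hyp_mul_cosh_sub_sinh_le hx hx1
    linarith

end Summit.RiemannHypothesis.RiemannHypothesis.Theorems
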